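import Summits.Ventures.PackingBounds.Energy.UniversalOptimality

/-!
# The regular cross-polytope `{±e_i}` as an explicit `2n`-point configuration on `S^{n-1}`, every `n`

Framing: lottery ticket; floor = certified bounds/negative ranges. Venture `PackingBounds` (cell
`pub-packcert`, seat `pub-packcert-energy`) — the **attained side**, structural (no kernel
computation, all dimensions at once).

The `2n` unit vectors `±e_i` of `ℝⁿ` have pairwise inner products `-1` (the antipode, once) and `0`
(`2n - 2` times), so for every potential `a` their `a`-energy is `2n (a(-1) + (2n-2) a(0))`
(`exists_config`). With the cell's kernel-checked universal optimality of the cross-polytopes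
(`Energy.UniversalCrossPolytope…`, Cohn–Kumar 2007 Table 1, every `n ≥ 3`) this is the ground-state
energy of `2n` points on `S^{n-1}` for every absolutely monotonic potential (`energy_isLeast`).

## References
* H. Cohn, A. Kumar, J. Amer. Math. Soc. 20 (2007) 99–148, Thm 1.2, Table 1. [`CohnKumar2006`]
-/

namespace Summit.Ventures.PackingBounds.Config.CrossPolytope

open Finset

/-- The sign attached to a Boolean. -/
private noncomputable def sgn (b : Bool) : ℝ := if b then 1 else -1

/-- The vertex `±e_i` attached to `(i, b)`. -/
private noncomputable def pt {n : ℕ} (p : Fin n × Bool) : EuclideanSpace ℝ (Fin n) :=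
  EuclideanSpace.single p.1 (sgn p.2)

/-- `sgn b² = 1`. -/
private theorem sgn_mul_self (b : Bool) : sgn b * sgn b = 1 := by
  unfold sgn; split <;> norm_num

/-- Inner products of the vertices: `±δ_ij`. -/
private theorem inner_pt {n : ℕ} (p q : Fin n × Bool) :
    inner ℝ (pt p) (pt q) = if p.1 = q.1 then sgn p.2 * sgn q.2 else 0 := by
  rw [pt, pt, EuclideanSpace.inner_single_left]
  simp only [conj_trivial, PiLp.single_apply]
  split_ifs with h1
  · rfl
  · rw [mul_zero]

/-- The vertices are unit vectors. -/
private theorem norm_pt {n : ℕ} (p : Fin n × Bool) : ‖pt p‖ = 1 := by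
  have h : inner ℝ (pt p) (pt p) = 1 := by rw [inner_pt, if_pos rfl, sgn_mul_self]
  rw [real_inner_self_eq_norm_sq] at h
  nlinarith [norm_nonneg (pt p)]

/-- Distinct labels give distinct vertices. -/
private theorem pt_injective {n : ℕ} : Function.Injective (pt (n := n)) := by
  rintro ⟨i, b⟩ ⟨j, c⟩ h
  have hin : inner ℝ (pt (i, b)) (pt (j, c)) = 1 := by
    rw [h, real_inner_self_eq_norm_sq, norm_pt, one_pow]
  rw [inner_pt] at hin
  split_ifs at hin with h1
  · simp only at h1
    subst h1
    cases b <;> cases c <;> simp_all [sgn] <;> norm_num at hin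
  · norm_num at hin

/-- For the vertex `(i, b)`, the inner products with the other vertices: `-1` with the antipode
`(i, ¬b)`, `0` with all `q` with `q.1 ≠ i`. -/
private theorem sum_erase_pt {n : ℕ} (a : ℝ → ℝ) (i : Fin n) (b : Bool) :
    ∑ q ∈ (univ : Finset (Fin n × Bool)).erase (i, b), a (inner ℝ (pt (i, b)) (pt q)) =
      a (-1) + (2 * n - 2 : ℝ) * a 0 := by
  classical
  have hanti : (i, !b) ∈ (univ : Finset (Fin n × Bool)).erase (i, b) := by simp
  rw [← Finset.add_sum_erase _ _ hanti]
  have h1 : a (inner ℝ (pt (i, b)) (pt (i, !b))) = a (-1) := by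
    rw [inner_pt, if_pos rfl]
    congr 1
    cases b <;> simp [sgn]
  have hset : ((univ : Finset (Fin n × Bool)).erase (i, b)).erase (i, !b) =
      (univ : Finset (Fin n × Bool)).filter (fun q => q.1 ≠ i) := by
    ext ⟨j, c⟩
    simp only [mem_erase, mem_univ, and_true, mem_filter, true_and, ne_eq, Prod.mk.injEq, not_and]
    constructor
    · rintro ⟨h2, h3⟩ hji
      subst hji
      cases b <;> cases c <;> simp_all
    · intro h
      exact ⟨fun h' => absurd h' h, fun h' => absurd h' h⟩
  have hcard : ((univ : Finset (Fin n × Bool)).filter (fun q => q.1 ≠ i)).card = 2 * n - 2 := by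
    have h := Finset.card_filter_add_card_filter_not
      (s := (univ : Finset (Fin n × Bool))) (fun q => q.1 = i)
    have hc : ((univ : Finset (Fin n × Bool)).filter (fun q => q.1 = i)).card = 2 := by
      rw [show ((univ : Finset (Fin n × Bool)).filter (fun q => q.1 = i)) =
          ({i} : Finset (Fin n)) ×ˢ (univ : Finset Bool) by
            ext ⟨j, c⟩; cases c <;> simp]
      simp
    rw [hc, card_univ, Fintype.card_prod, Fintype.card_fin, Fintype.card_bool] at h
    simp only [ne_eq] at h ⊢
    omega
  rw [h1, hset, Finset.sum_congr rfl (g := fun _ => a 0) (fun q hq => by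
      rw [mem_filter] at hq
      rw [inner_pt, if_neg (Ne.symm hq.2)]), sum_const, nsmul_eq_mul, hcard]
  have hn : 1 ≤ n := Nat.one_le_of_lt i.2
  rw [Nat.cast_sub (by omega)]
  push_cast
  ring

/-- **The cross-polytope configuration.** For every `n` there are `2n` unit vectors of `ℝⁿ` (the
`±e_i`) with pairwise inner products `-1` or `0` (in particular `≤ 0`), whose `a`-energy is
`2n (a(-1) + (2n-2) a(0))` for every potential `a`. [cite: CohnKumar2006, Table 1] -/
theorem exists_config (n : ℕ) : ∃ C : Finset (EuclideanSpace ℝ (Fin n)), C.card = 2 * n ∧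
    (∀ x ∈ C, ‖x‖ = 1) ∧ (∀ x ∈ C, ∀ y ∈ C, x ≠ y → inner ℝ x y = -1 ∨ inner ℝ x y = 0) ∧
    ∀ a : ℝ → ℝ, ∑ x ∈ C, ∑ y ∈ C.erase x, a (inner ℝ x y) =
      (2 * n : ℝ) * (a (-1) + (2 * n - 2) * a 0) := by
  classical
  refine ⟨(univ : Finset (Fin n × Bool)).map ⟨pt, pt_injective⟩, ?_, ?_, ?_, ?_⟩
  · simp [card_univ, Fintype.card_prod, Fintype.card_bool, mul_comm]
  · intro x hx
    obtain ⟨p, -, rfl⟩ := Finset.mem_map.1 hx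
    exact norm_pt p
  · intro x hx y hy hxy
    obtain ⟨⟨i, b⟩, -, rfl⟩ := Finset.mem_map.1 hx
    obtain ⟨⟨j, c⟩, -, rfl⟩ := Finset.mem_map.1 hy
    simp only [Function.Embedding.coeFn_mk] at hxy ⊢
    rw [inner_pt]
    split_ifs with h
    · left
      simp only at h
      subst h
      have hne : b ≠ c := fun h2 => hxy (by rw [h2])
      revert hne
      cases b <;> cases c <;> norm_num [sgn]
    · right; rfl
  · intro a
    rw [Finset.sum_map]
    have hterm : ∀ p : Fin n × Bool,
        ∑ y ∈ ((univ : Finset (Fin n × Bool)).map ⟨pt, pt_injective⟩).erase (pt p),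
          a (inner ℝ (pt p) y) = a (-1) + (2 * n - 2 : ℝ) * a 0 := by
      rintro ⟨i, b⟩
      have he : ((univ : Finset (Fin n × Bool)).map ⟨pt, pt_injective⟩).erase (pt (i, b)) =
          ((univ : Finset (Fin n × Bool)).erase (i, b)).map ⟨pt, pt_injective⟩ := by
        rw [Finset.map_erase]; rfl
      rw [he, Finset.sum_map]
      exact sum_erase_pt a i b
    simp only [Function.Embedding.coeFn_mk, hterm, sum_const, card_univ, Fintype.card_prod,
      Fintype.card_fin, Fintype.card_bool, nsmul_eq_mul]
    push_cast
    ring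

/-- **Ground-state energy of `2n` points on `S^{n-1}`, `n ≥ 3`.** For every potential `a` absolutely
monotonic on `[-1,1)`, the least `a`-energy of `2n` unit vectors of `ℝⁿ` is `2n (a(-1) + (2n-2) a(0))`,
attained by the cross-polytope (universal optimality, Cohn–Kumar 2007, lower bound kernel-checked in
`Energy/UniversalOptimalityCrossPolytope` for all `n ≥ 3` at once). [cite: CohnKumar2006, Theorem 1.2] -/
theorem energy_isLeast {n : ℕ} (hn : 3 ≤ n) (a : ℝ → ℝ)
    (ha : AbsolutelyMonotoneOn a (Set.Ico (-1) 1)) :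
    IsLeast {E : ℝ | ∃ C : Finset (EuclideanSpace ℝ (Fin n)), (∀ x ∈ C, ‖x‖ = 1) ∧ C.card = 2 * n ∧
      E = ∑ x ∈ C, ∑ y ∈ C.erase x, a (inner ℝ x y)}
      ((2 * n : ℝ) * (a (-1) + (2 * n - 2) * a 0)) := by
  obtain ⟨C, hc, hn1, -, he⟩ := exists_config n
  refine ⟨⟨C, hn1, hc, (he a).symm⟩, ?_⟩
  rintro E ⟨C', h1, hN, rfl⟩
  exact Energy.UniversalCrossPolytope.universallyOptimal_of_absolutelyMonotoneOn hn a ha C' h1 hN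

end Summit.Ventures.PackingBounds.Config.CrossPolytope
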